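import Summits.NavierStokesRegularity.NavierStokesRegularity.Theses.AngularGalerkinLadder
import Summits.NavierStokesRegularity.NavierStokesRegularity.Theorems.RungBlowupCofinal.LerayLineRungProfile

/-!
# K1 `RungBlowupCofinal` FROM COFINAL LERAY ROOTS — the one-stub «Leray line» composition

Circuit seat (ns-blowup-circuit g10), `--supports` crux K1 `RungBlowupCofinal`
(stmt-NavierStokesRegularity-19959) of route `AngularGalerkinLadder` as a helper; no definition, no
named fact; a CONDITIONAL composition (the hypothesis is spelled out inline, not registered).

The registered K1 skeleton (`Cruxes/RungBlowupCofinal/Lines/birth.lean` v4) reaches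
`RungBlowupCofinal` through FORWARD rung blow-up from smooth decaying data plus a tangent-flow
extraction (`stub_forward_dss_blowup_cofinal` XL → `stub_tangent_flow_closure` L). K1 AS TYPED asks
only for nontrivial Type-I rotated-DSS ANCIENT rung profiles, and EXACTLY self-similar ones qualify
(`LerayLineRungProfile.rungIsSingular_of_lerayProfile`, p517517). Hence a strictly shorter
candidate line with ONE analytic stub — «cofinally in `L`, the rung-`L` steady Leray system with a
co-band-limited defect has a nontrivial smooth band-limited solution with Type-I decay» — closes K1:
`rungBlowupCofinal_of_lerayRoots` below (kernel-checked composition; the stub is its hypothesis,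
verbatim). MODEL support for the stub: the cell's `O_h` Leray roots at rungs 4, 6, 8 (Z2-OCT
OCT-P93 + ℓ-ladder; float64, two codes at rung 4); their shell radius grows like `ρ_A ≈ 3.3·L`
(HOME/circuit/agl/LERAY-LINE-READING.md §3), suggesting an `L → ∞` asymptotic construction
(cutoff-riding roots) as the analytic route to the stub. CENSUS CAVEAT (kernel, p515522): rungs made
singular this way still owe K2 a DIFFERENT (non-self-similar, e.g. precessing or DSS) window profile
— the Leray line is K1-only.

LABEL: KERNEL (composition). WHAT THIS IS NOT: not NS, not a proof of K1 — the hypothesis is an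
unregistered analytic statement about the TRUNCATED model, uncertified at every rung; no item moves.
References: [cite: NecasRuzickaSverak1996, (1.3)–(1.5)]; [cite: KochNadirashviliSereginSverak2009, (1.6)];
[cite: ChaeWolf2017RemovingDSS, Def. 1.1].
-/

noncomputable section

namespace Summit.NavierStokesRegularity.AngularGalerkinLadderLerayLineCofinal

open Set MeasureTheory Filter Topology Function
open scoped Laplacian ContDiff
open Literature.Analysis.FluidPDE
open Summit.NavierStokesRegularity.FluidComputer
open Summit.NavierStokesRegularity.FluidComputer.AngularLadder
open Summit.NavierStokesRegularity.NavierStokesRegularity.Theses.AngularGalerkinLadder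
open Summit.NavierStokesRegularity.AngularGalerkinLadderLerayLine

/-- **K1 from cofinal Leray roots.** If for every level `L₀` some rung `L ≥ L₀` carries a smooth
band-limited steady Leray profile with co-band-limited defect — `U, P ∈ C^∞`,
`−ΔU + ½U + ½(y·∇)U + (U·∇)U + ∇P = D`, `div U = 0`, `IsBandLimited L U`, `IsCobandLimited L D`,
`‖U(y)‖ ≤ C/(‖y‖+1)`, `U ≢ 0` — then `RungBlowupCofinal` holds (each such rung is singular by
`rungIsSingular_of_lerayProfile`). The hypothesis is the ONE stub of the «Leray line».
[cite: NecasRuzickaSverak1996, (1.3)–(1.5)] [cite: KochNadirashviliSereginSverak2009, (1.6)] -/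
theorem rungBlowupCofinal_of_lerayRoots
    (h : ∀ L₀ : ℕ, ∃ L ≥ L₀, ∃ (C : ℝ)
      (U D : EuclideanSpace ℝ (Fin 3) → EuclideanSpace ℝ (Fin 3)) (P : EuclideanSpace ℝ (Fin 3) → ℝ),
      ContDiff ℝ ∞ U ∧ ContDiff ℝ ∞ P ∧
      (∀ y, -((Δ U) y) + (1 / 2 : ℝ) • U y + (1 / 2 : ℝ) • fderiv ℝ U y y + convect U U y +
        gradient P y = D y) ∧
      VectorCalculus.IsDivFree U ∧ IsBandLimited L U ∧ IsCobandLimited L D ∧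
      (∀ y, ‖U y‖ ≤ C / (‖y‖ + 1)) ∧ ∃ y, U y ≠ 0) :
    RungBlowupCofinal := by
  intro L₀
  obtain ⟨L, hL, C, U, D, P, hU, hP, heq, hdiv, hband, hcob, hdec, hne⟩ := h L₀
  exact ⟨L, hL, rungIsSingular_of_lerayProfile hU hP heq hdiv hband hcob hdec hne⟩

/-- **One rung.** A single Leray root at rung `L` makes that rung singular — the instance form
(e.g. `L = 4` for a certified `O_h` root), recorded next to the cofinal composition for the census.
[cite: NecasRuzickaSverak1996, (1.3)–(1.5)] -/
theorem rungIsSingular_of_lerayRoot {L : ℕ}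
    (h : ∃ (C : ℝ) (U D : EuclideanSpace ℝ (Fin 3) → EuclideanSpace ℝ (Fin 3))
      (P : EuclideanSpace ℝ (Fin 3) → ℝ),
      ContDiff ℝ ∞ U ∧ ContDiff ℝ ∞ P ∧
      (∀ y, -((Δ U) y) + (1 / 2 : ℝ) • U y + (1 / 2 : ℝ) • fderiv ℝ U y y + convect U U y +
        gradient P y = D y) ∧
      VectorCalculus.IsDivFree U ∧ IsBandLimited L U ∧ IsCobandLimited L D ∧
      (∀ y, ‖U y‖ ≤ C / (‖y‖ + 1)) ∧ ∃ y, U y ≠ 0) :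
    RungIsSingular L := by
  obtain ⟨C, U, D, P, hU, hP, heq, hdiv, hband, hcob, hdec, hne⟩ := h
  exact rungIsSingular_of_lerayProfile hU hP heq hdiv hband hcob hdec hne

/-- **Eventually-all form.** If EVERY rung beyond some level carries a Leray root then, a fortiori,
`RungBlowupCofinal`. (The ℓ-ladder reading — a root at every even rung ≥ 4 — would be used in this
form with `L ↦` the next even rung.) [cite: NecasRuzickaSverak1996, (1.3)–(1.5)] -/
theorem rungBlowupCofinal_of_lerayRoots_eventually {L₁ : ℕ}
    (h : ∀ L ≥ L₁, ∃ L' ≥ L, ∃ (C : ℝ)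
      (U D : EuclideanSpace ℝ (Fin 3) → EuclideanSpace ℝ (Fin 3)) (P : EuclideanSpace ℝ (Fin 3) → ℝ),
      ContDiff ℝ ∞ U ∧ ContDiff ℝ ∞ P ∧
      (∀ y, -((Δ U) y) + (1 / 2 : ℝ) • U y + (1 / 2 : ℝ) • fderiv ℝ U y y + convect U U y +
        gradient P y = D y) ∧
      VectorCalculus.IsDivFree U ∧ IsBandLimited L' U ∧ IsCobandLimited L' D ∧
      (∀ y, ‖U y‖ ≤ C / (‖y‖ + 1)) ∧ ∃ y, U y ≠ 0) :
    RungBlowupCofinal := by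
  refine rungBlowupCofinal_of_lerayRoots fun L₀ => ?_
  obtain ⟨L', hL', rest⟩ := h (max L₀ L₁) (le_max_right _ _)
  exact ⟨L', le_trans (le_max_left _ _) hL', rest⟩

end Summit.NavierStokesRegularity.AngularGalerkinLadderLerayLineCofinal

end
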